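import Summits.SmoothPoincare4.SmoothPoincare4.Theses.SteinHost

/-!
# Negative lemmas for the crux `SteinHost.HostStein` (stmt-SmoothPoincare4-19247): the hypothesis is
# load-bearing, and a Stein host is never closed

The crux `Summit.SmoothPoincare4.SmoothPoincare4.Theses.SteinHost.HostStein` (route SteinHost, rank 3,
embedding form) asserts: for every Hausdorff second-countable `C^∞` 4-manifold `M ≃ₕ S⁴` there are a
point `p ∈ M`, a compact `C^∞` 4-manifold with boundary `X` with `IsSteinDomain X`, and a smooth embedding
`M ∖ {p} ↪ X`.  Refuter crux-attack (birth vetting, 2026-08-17) found no refutation (the statement is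
implied by `SmoothPoincare4` itself with host `𝔻⁴`, so a counterexample is an exotic `S⁴`); this file
records the two kernel-checked by-products of the attack, over the tree's own vocabulary:

* `hostStein_false_without_homotopyEquiv` — the crux text verbatim with the hypothesis `M ≃ₕ S⁴` deleted
  is FALSE: the empty 4-manifold (`PEmpty`, Mathlib `ChartedSpace.empty` / `IsManifold.empty`) has no
  point `p`.  (Degenerate witness; the substantive content of the hypothesis — `H₂(M; ℤ) = 0` — is what
  excludes e.g. `M = ℂℙ²`, whose punctured copy carries an essential `(+1)`-sphere that no Stein surface
  contains by the Lisca–Matić adjunction inequality; that inequality is not in the tree.)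
* `steinStructure_exists_isBoundaryPoint`, `not_isSteinDomain_of_boundarylessManifold` — every Stein
  structure on a non-empty compact `X` has a boundary point (its `J`-convex function attains its supremum,
  and `SteinStructure.boundary_eq` places every maximum point on `∂X`); hence NO compact boundaryless
  4-manifold recharted on the half-space — in particular not `M` itself — is a Stein host: the cheapest
  junk witness for the `∃ X` of the crux is excluded by the tree's `IsSteinDomain`.

Refuter negative lemmas (`--supports stmt-SmoothPoincare4-19247`); no statement of the route is asserted.
-/

noncomputable section

set_option linter.dupNamespace false

namespace Summit.SmoothPoincare4.SmoothPoincare4.Theorems.HostStein.Negative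

open scoped Manifold ContDiff Topology ContinuousMap
open Literature.Geometry.Symplectic

/-- **The hypothesis `M ≃ₕ S⁴` is load-bearing.**  The crux `HostStein` with its only hypothesis deleted —
"every Hausdorff second-countable `C^∞` 4-manifold `M` has a point `p` and a compact Stein host of
`M ∖ {p}`" — is false: the empty manifold has no point.  Statement = the served body verbatim minus the
binder `M ≃ₕ Metric.sphere 0 1 →`. [folklore] -/
theorem hostStein_false_without_homotopyEquiv :
    ¬ (∀ (M : Type) [TopologicalSpace M] [T2Space M] [SecondCountableTopology M]
        [ChartedSpace (EuclideanSpace ℝ (Fin 4)) M] [IsManifold (𝓡 4) ∞ M],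
        ∃ (p : M) (X : Type) (_ : TopologicalSpace X) (_ : T2Space X) (_ : SecondCountableTopology X)
          (_ : ChartedSpace (EuclideanHalfSpace 4) X) (_ : IsManifold (𝓡∂ 4) ∞ X) (_ : CompactSpace X),
          IsSteinDomain X ∧
            ∃ f : (⟨{p}ᶜ, isOpen_compl_singleton⟩ : TopologicalSpace.Opens M) → X,
              Manifold.IsSmoothEmbedding (𝓡 4) (𝓡∂ 4) ∞ f) := by
  intro h
  letI : ChartedSpace (EuclideanSpace ℝ (Fin 4)) PEmpty.{1} := ChartedSpace.empty _ _
  haveI : IsManifold (𝓡 4) ∞ PEmpty.{1} := IsManifold.empty _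
  obtain ⟨p, -⟩ := h PEmpty
  exact p.elim

/-- **A Stein structure sees the boundary.**  On a non-empty compact `X`, the `J`-convex function `φ` of
any `SteinStructure X` attains its supremum at some point, and `boundary_eq` says exactly the points where
`φ = sSup (range φ)` are boundary points; so `∂X ≠ ∅`. [cite: Gompf1998, §1] -/
theorem steinStructure_exists_isBoundaryPoint (X : Type*) [TopologicalSpace X]
    [ChartedSpace (EuclideanHalfSpace 4) X] [IsManifold (𝓡∂ 4) ∞ X] [CompactSpace X] [Nonempty X]
    (S : SteinStructure X) : ∃ x : X, (𝓡∂ 4).IsBoundaryPoint x := by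
  have hc : Continuous S.φ := S.φ_smooth.continuous
  obtain ⟨x, -, hx⟩ := isCompact_univ.exists_isMaxOn Set.univ_nonempty hc.continuousOn
  refine ⟨x, (S.boundary_eq x).2 ?_⟩
  have hb : BddAbove (Set.range S.φ) := by
    simpa [Set.image_univ] using (isCompact_univ.image hc).isBounded.bddAbove
  apply le_antisymm
  · exact le_csSup hb (Set.mem_range_self x)
  · exact csSup_le (Set.range_nonempty _) (by rintro _ ⟨y, rfl⟩; exact hx (Set.mem_univ y))

/-- **No closed Stein host.**  A non-empty compact 4-manifold charted on the half-space WITHOUT boundary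
points (`BoundarylessManifold`, e.g. a closed 4-manifold such as `M` itself recharted on the open
half-space) carries no Stein structure: `¬ IsSteinDomain X`.  Consequently the host `X` produced by any
proof of `HostStein` has non-empty boundary, and the junk witness "`X := M`" is unavailable. [folklore] -/
theorem not_isSteinDomain_of_boundarylessManifold (X : Type*) [TopologicalSpace X]
    [ChartedSpace (EuclideanHalfSpace 4) X] [IsManifold (𝓡∂ 4) ∞ X] [CompactSpace X] [Nonempty X]
    [BoundarylessManifold (𝓡∂ 4) X] : ¬ IsSteinDomain X := by
  rintro ⟨S⟩
  obtain ⟨x, hx⟩ := steinStructure_exists_isBoundaryPoint X S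
  exact (ModelWithCorners.isInteriorPoint_iff_not_isBoundaryPoint x).1
    (BoundarylessManifold.isInteriorPoint' x) hx

end Summit.SmoothPoincare4.SmoothPoincare4.Theorems.HostStein.Negative

end
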